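import Mathlib
import HarnessLib
import Summits.Ventures.LatticeQCDFlow.Scoring.ChainPathLaw

/-!
# The chain of a constant kernel is the product measure: independent draws ARE the `ε = 1` chain,
# as a law on path space

HONEST FRAMING: exact (Metropolis-corrected) sampling algorithms for lattice gauge theory;
figures of merit are autocorrelation/cost numbers at stated couplings and volumes; no
continuum-physics claim.

Venture `LatticeQCDFlow` (cell pub-lqcd), topic `Scoring`; FANOUT row 8 (`s0-cpn-nemc`, GEN-15).
NEW WORK of the cell, not a published result; no definition is introduced.  The row's certificates
are calibrated against the independent sampler (`ε = 1`: `κ(x, ·) = π`, variance factor `2/ε − 1 = 1`,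
no burn-in); the coin coordinate of the split chain (`Scoring/SplitChain.lean`,
`splitChain_map_snd`) is the chain of a CONSTANT kernel.  This file identifies such chains with
Mathlib's product measure `Measure.infinitePi` — so "i.i.d." statements (Mathlib's `iIndepFun`,
strong law, CLT machinery) apply to them verbatim — by one more application of the uniqueness
theorem `eq_chain_of_tower` of `Scoring/ChainPathLaw.lean`: the product measure has the right
time-`0` marginal (`Measure.infinitePi_map_eval`) and satisfies the tower identities of the
constant kernel because its coordinates are independent (`iIndepFun_infinitePi`).  Printed
counterpart NAMED ONLY: Kolmogorov's extension / the i.i.d. sequence as a Markov chain with constant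
transition law (Kallenberg 2021 Ch. 4 and Ch. 11); nothing is cited as a fact.

## Content (`S` a measurable space, `m`, `μ₀` probability laws on `S`)

* **`chain_const_eq_infinitePi`** — `P_{μ₀, const m} = Measure.infinitePi (n ↦ if n = 0 then μ₀ else m)`;
* **`chain_const_iid`** — `P_{m, const m} = Measure.infinitePi (fun _ ↦ m)`: the independent
  sampler's run IS the i.i.d. product law;
* **`chain_const_iIndepFun`** — under `P_{μ₀, const m}` the coordinates `x ↦ x n` are mutually
  independent (`iIndepFun`), with laws `μ₀` (time `0`) and `m` (times `≥ 1`,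
  `chain_const_map_eval_succ`).

NOT CLAIMED: anything about a non-constant kernel; rates.
-/

noncomputable section

namespace Summit.Ventures.LatticeQCDFlow.Scoring

open MeasureTheory ProbabilityTheory Filter Finset Preorder
open scoped ENNReal

variable {S : Type*} [MeasurableSpace S]

/-- The one-parameter family "`μ₀` at time `0`, `m` afterwards" consists of probability laws. -/
theorem isProbabilityMeasure_initThenConst (m : Measure S) [IsProbabilityMeasure m]
    (μ₀ : Measure S) [IsProbabilityMeasure μ₀] (n : ℕ) :
    IsProbabilityMeasure ((fun k : ℕ => if k = 0 then μ₀ else m) n) := by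
  simp only
  split_ifs <;> infer_instance

/-- The transition operator of a constant kernel is the constant `m(g)`. -/
theorem kop_constKernel (m : Measure S) (g : S → ℝ) (y : S) :
    kop (Kernel.const S m) g y = ∫ z, g z ∂m := by
  simp [kop, Kernel.const_apply]

/-- **THE CHAIN OF A CONSTANT KERNEL IS THE PRODUCT MEASURE**: for probability laws `μ₀`, `m` on
`S`, the Ionescu-Tulcea law of the chain with the constant kernel `const m` started in `μ₀` is
Mathlib's `Measure.infinitePi (n ↦ if n = 0 then μ₀ else m)`. -/
theorem chain_const_eq_infinitePi (m : Measure S) [IsProbabilityMeasure m] (μ₀ : Measure S)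
    [IsProbabilityMeasure μ₀] :
    Kernel.trajMeasure (X := fun _ : ℕ => S) μ₀
        (fun n : ℕ => (Kernel.const S m).comap (fun h : (i : ↥(Finset.Iic n)) → S =>
          h ⟨n, Finset.mem_Iic.2 le_rfl⟩) (measurable_pi_apply _))
      = Measure.infinitePi (fun n : ℕ => if n = 0 then μ₀ else m) := by
  haveI hI : ∀ n : ℕ, IsProbabilityMeasure ((fun k : ℕ => if k = 0 then μ₀ else m) n) :=
    isProbabilityMeasure_initThenConst m μ₀
  symm
  refine eq_chain_of_tower (Kernel.const S m) μ₀ _ ?_ ?_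
  · rw [Measure.infinitePi_map_eval]
    exact if_pos rfl
  · intro a F hF CF hCF g hg Cg hCg
    have hind := (iIndepFun_infinitePi (P := fun n : ℕ => if n = 0 then μ₀ else m)
      (X := fun (_ : ℕ) (y : S) => y) (fun _ => measurable_id)).indepFun_finset (Finset.Iic a)
      ({a + 1} : Finset ℕ) (by simp) (fun _ => measurable_pi_apply _)
    have hm2 : Measurable fun (ω : ℕ → S) (i : ↥({a + 1} : Finset ℕ)) => ω i :=
      measurable_pi_lambda _ fun i => measurable_pi_apply _
    have hg' : Measurable fun y : (i : ↥({a + 1} : Finset ℕ)) → S =>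
        g (y ⟨a + 1, Finset.mem_singleton_self _⟩) := hg.comp (measurable_pi_apply _)
    have h2 : ∫ ω, F (frestrictLe a ω) * g (ω (a + 1))
          ∂(Measure.infinitePi (fun n : ℕ => if n = 0 then μ₀ else m))
        = (∫ ω, F (frestrictLe a ω) ∂(Measure.infinitePi (fun n : ℕ => if n = 0 then μ₀ else m)))
          * ∫ ω, g (ω (a + 1)) ∂(Measure.infinitePi (fun n : ℕ => if n = 0 then μ₀ else m)) :=
      hind.integral_fun_comp_mul_comp (measurable_frestrictLe a).aemeasurable hm2.aemeasurable
        hF.aestronglyMeasurable hg'.aestronglyMeasurable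
    have h3 : ∫ ω, g (ω (a + 1)) ∂(Measure.infinitePi (fun n : ℕ => if n = 0 then μ₀ else m))
        = ∫ z, g z ∂m := by
      rw [← integral_map (measurable_pi_apply (a + 1)).aemeasurable hg.aestronglyMeasurable,
        Measure.infinitePi_map_eval]
      simp
    simp_rw [kop_constKernel]
    rw [integral_mul_const, h2, h3]

/-- **THE INDEPENDENT SAMPLER'S RUN IS THE I.I.D. PRODUCT LAW**:
`P_{m, const m} = Measure.infinitePi (fun _ ↦ m)`. -/
theorem chain_const_iid (m : Measure S) [IsProbabilityMeasure m] :
    Kernel.trajMeasure (X := fun _ : ℕ => S) m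
        (fun n : ℕ => (Kernel.const S m).comap (fun h : (i : ↥(Finset.Iic n)) → S =>
          h ⟨n, Finset.mem_Iic.2 le_rfl⟩) (measurable_pi_apply _))
      = Measure.infinitePi (fun _ : ℕ => m) := by
  rw [chain_const_eq_infinitePi]
  congr 1
  funext n
  split_ifs <;> rfl

/-- **Under the constant-kernel chain the coordinates are mutually independent.** -/
theorem chain_const_iIndepFun (m : Measure S) [IsProbabilityMeasure m] (μ₀ : Measure S)
    [IsProbabilityMeasure μ₀] :
    iIndepFun (fun (n : ℕ) (x : ℕ → S) => x n)
      (Kernel.trajMeasure (X := fun _ : ℕ => S) μ₀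
        (fun n : ℕ => (Kernel.const S m).comap (fun h : (i : ↥(Finset.Iic n)) → S =>
          h ⟨n, Finset.mem_Iic.2 le_rfl⟩) (measurable_pi_apply _))) := by
  haveI hI : ∀ n : ℕ, IsProbabilityMeasure ((fun k : ℕ => if k = 0 then μ₀ else m) n) :=
    isProbabilityMeasure_initThenConst m μ₀
  rw [chain_const_eq_infinitePi]
  exact iIndepFun_infinitePi (P := fun n : ℕ => if n = 0 then μ₀ else m)
    (X := fun (_ : ℕ) (y : S) => y) (fun _ => measurable_id)

/-- … with law `m` at every time `n + 1` (and `μ₀` at time `0`, `chain_map_eval_zero`). -/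
theorem chain_const_map_eval_succ (m : Measure S) [IsProbabilityMeasure m] (μ₀ : Measure S)
    [IsProbabilityMeasure μ₀] (n : ℕ) :
    (Kernel.trajMeasure (X := fun _ : ℕ => S) μ₀
        (fun n : ℕ => (Kernel.const S m).comap (fun h : (i : ↥(Finset.Iic n)) → S =>
          h ⟨n, Finset.mem_Iic.2 le_rfl⟩) (measurable_pi_apply _))).map (fun x : ℕ → S => x (n + 1))
      = m := by
  haveI hI : ∀ n : ℕ, IsProbabilityMeasure ((fun k : ℕ => if k = 0 then μ₀ else m) n) :=
    isProbabilityMeasure_initThenConst m μ₀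
  rw [chain_const_eq_infinitePi, Measure.infinitePi_map_eval]
  exact if_neg (Nat.succ_ne_zero n)

end Summit.Ventures.LatticeQCDFlow.Scoring

end
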